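import Summits.MatrixMultiplication.MatrixMultiplication.Theorems.FarEdgeDescentSignTwistDet
import Summits.MatrixMultiplication.MatrixMultiplication.Theorems.FarEdgeDescentWeightFamily
import HarnessLib

/-!
# `𝔖(q) ⋭ ⟨2,2,2⟩` for every `q ≠ 1`: the coherent point is degeneration-incomparable with its
# whole same-support family

Route `FarEdgeDescent` (cell `decomp-mm`, lens 2 «structural dichotomy (special vs generic)»,
gen 32), Kernel VII; support for the aside `SubLogRate` (stmt-MatrixMultiplication-25371).

`FarEdgeDescentWeightFamily` proved `⟨2,2,2⟩ ⋭ 𝔖(q)` (`q ∉ {0,1}`, commutant growth).  This file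
proves the CONVERSE non-degeneration by the determinant class of the `y`-pencil
(`FarEdgeDescentSignTwistDet`, there for `q = -1` only): the `y`-slice of `𝔖(q)` is
`Y ⊕ Y^{(q)}` with `det = det Y · (y₀₀y₁₁ - q·y₀₁y₁₀)` (`det_Smat_fam`), while that of `⟨2,2,2⟩`
has `det = (det X)²`.  Under a degeneration `𝔖(q) ⊵ ⟨2,2,2⟩` the trailing `ε`-coefficients would
give `(det X)² = w · P · Q` with `P`, `Q` the trailing coefficients of `u - v` and `u - q v`
(`u = y₀₀y₁₁`, `v = y₀₁y₁₀`, all `ε`-coefficients of the `y`'s linear forms), whence both are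
constant multiples of `det X`; `trailing_contradiction_q` shows this is absurd for EVERY `q ≠ 1`
(at the least order the coefficients `a, b` of `u, v` satisfy `a - b = κ₁ det X`,
`a - q b = κ₂ det X`, so `(q-1) b`, and then `a`, are multiples of `det X`; but the one attaining
the least order is a non-zero product of two linear forms).  No assumption on the characteristic
and none on `q` other than `q ≠ 1` (for `q = 1`, `𝔖(1) ≅ ⟨2,2,2⟩`).

* `fam_not_algDegeneratesTo_matMul`: **`𝔖(q) ⋭ ⟨2,2,2⟩` for all `q ≠ 1`, every field**;
* `matMul_fam_incomparable`: with `FarEdgeDescentWeightFamily`, **`⟨2,2,2⟩` and `𝔖(q)` are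
  degeneration-incomparable for every `q ∉ {0,1}` over every field** — the coherent point of the
  Bläser–Christandl–Zuiddam normal-form family is comparable with no other member, although all
  members share support, flattening ranks and (over `ℂ`) border rank.

References: M. Bläser, M. Christandl, J. Zuiddam, arXiv:1705.09652, §2
[BlaserChristandlZuiddam2017]; P. Bürgisser, M. Clausen, M. A. Shokrollahi, *Algebraic
Complexity Theory* (1997), §15.4, (15.19), §20.2 [BurgisserClausenShokrollahi1997].
-/

noncomputable section

open scoped BigOperators Polynomial

set_option linter.dupNamespace false

namespace Summit.MatrixMultiplication.MatrixMultiplication.Theorems.FarEdgeDescentWeightFamilyDet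

open Literature.Computability.AlgebraicComplexity
open Summit.MatrixMultiplication.MatrixMultiplication.Theorems.FarEdgeDescentSignTwist
open Summit.MatrixMultiplication.MatrixMultiplication.Theorems.FarEdgeDescentSignTwistDet
open Summit.MatrixMultiplication.MatrixMultiplication.Theorems.FarEdgeDescentWeightFamily

universe u

variable {K : Type u} [Field K]

/-! ## The trailing contradiction for the pair `(u - v, u - q v)` -/

/-- **The trailing contradiction, `q`-version.**  If every `ε`-coefficient of the four series
`y_b ∈ K[x][ε]` is a linear form in `x` and `q ≠ 1`, the trailing coefficients of
`y₀₀y₁₁ - y₀₁y₁₀` and `y₀₀y₁₁ - q·y₀₁y₁₀` cannot both be non-zero multiples of `det X`.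
[cite: BurgisserClausenShokrollahi1997, §15.4] -/
theorem trailing_contradiction_q {q : K} (hq1 : q ≠ 1) (y : Fin 2 × Fin 2 → (Rx K)[X])
    (HY : ∀ b k, ((y b).coeff k).IsHomogeneous 1) {κ₁ κ₂ : K} (hκ₁ : κ₁ ≠ 0) (hκ₂ : κ₂ ≠ 0)
    (h₁ : (y (0, 0) * y (1, 1) - y (0, 1) * y (1, 0)).trailingCoeff =
      MvPolynomial.C κ₁ * detX K)
    (h₂ : (y (0, 0) * y (1, 1) -
        y (0, 1) * y (1, 0) * Polynomial.C (MvPolynomial.C q)).trailingCoeff =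
      MvPolynomial.C κ₂ * detX K) : False := by
  set u := y (0, 0) * y (1, 1) with hu
  set v := y (0, 1) * y (1, 0) with hv
  have hC : ∀ {κ : K}, κ ≠ 0 → MvPolynomial.C κ * detX K ≠ 0 := fun hκ =>
    mul_ne_zero (by simpa using hκ) (detX_ne_zero K)
  -- a product of two of the `y`'s never has trailing coefficient `κ · det X`, `κ ≠ 0`
  have hprod : ∀ (b b' : Fin 2 × Fin 2) {κ : K}, κ ≠ 0 →
      (y b * y b').trailingCoeff ≠ MvPolynomial.C κ * detX K := by
    intro b b' κ hκ h
    obtain ⟨l, l', hl, hl', hll⟩ := trailingCoeff_mul_isHomogeneous (HY b) (HY b')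
    exact linear_mul_linear_ne_C_mul_detX hl hl' hκ (hll ▸ h)
  by_cases hv0 : v = 0
  · rw [hv0, sub_zero] at h₁
    exact hprod _ _ hκ₁ h₁
  by_cases hu0 : u = 0
  · -- `-v = (-y₀₁) · y₁₀` is again a product of series with linear coefficients
    have hneg : -v = (-y (0, 1)) * y (1, 0) := by rw [hv]; ring
    rw [hu0, zero_sub, hneg, Polynomial.trailingCoeff_mul] at h₁
    refine linear_mul_linear_ne_C_mul_detX ?_ (HY (1, 0) _) hκ₁ h₁
    rw [Polynomial.trailingCoeff, Polynomial.coeff_neg]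
    exact (HY (0, 1) _).neg
  -- both non-zero: look at the least order `m₀`
  set Cq : (Rx K)[X] := Polynomial.C (MvPolynomial.C q) with hCq
  have hsub0 : u - v ≠ 0 := fun h => hC hκ₁ (by rw [← h₁, h, Polynomial.trailingCoeff_zero])
  have hsubq0 : u - v * Cq ≠ 0 := fun h =>
    hC hκ₂ (by rw [← h₂, h, Polynomial.trailingCoeff_zero])
  set m₀ := min u.natTrailingDegree v.natTrailingDegree with hm₀
  have hlowu : ∀ k < m₀, u.coeff k = 0 := fun k hk =>
    Polynomial.coeff_eq_zero_of_lt_natTrailingDegree (lt_of_lt_of_le hk (min_le_left _ _))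
  have hlowv : ∀ k < m₀, v.coeff k = 0 := fun k hk =>
    Polynomial.coeff_eq_zero_of_lt_natTrailingDegree (lt_of_lt_of_le hk (min_le_right _ _))
  obtain ⟨αm, hαm⟩ := coeff_eq_C_mul_detX_of_trailing hsub0
    (fun k hk => by rw [Polynomial.coeff_sub, hlowu k hk, hlowv k hk, sub_zero]) h₁
  obtain ⟨αp, hαp⟩ := coeff_eq_C_mul_detX_of_trailing hsubq0
    (fun k hk => by
      rw [Polynomial.coeff_sub, Polynomial.coeff_mul_C, hlowu k hk, hlowv k hk, zero_mul, sub_zero])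
    h₂
  rw [Polynomial.coeff_sub] at hαm
  rw [Polynomial.coeff_sub, Polynomial.coeff_mul_C] at hαp
  have E : MvPolynomial.C ((q - 1)⁻¹ : K) * (MvPolynomial.C q - 1 : Rx K) = 1 := by
    rw [← map_one (MvPolynomial.C (σ := Fin 2 × Fin 2) (R := K)), ← map_sub, ← map_mul,
      inv_mul_cancel₀ (sub_ne_zero.mpr hq1)]
  have hb : v.coeff m₀ = MvPolynomial.C ((q - 1)⁻¹ * (αm - αp)) * detX K := by
    rw [map_mul, map_sub]
    linear_combination (MvPolynomial.C ((q - 1)⁻¹ : K)) * hαm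
      - (MvPolynomial.C ((q - 1)⁻¹ : K)) * hαp - v.coeff m₀ * E
  have ha : u.coeff m₀ = MvPolynomial.C ((q - 1)⁻¹ * (αm - αp) + αm) * detX K := by
    rw [map_add]
    linear_combination hαm + hb
  -- `m₀` is attained by `u` or by `v`; there the coefficient is the (non-zero) trailing one
  rcases min_choice u.natTrailingDegree v.natTrailingDegree with hm | hm
  · have htc : u.trailingCoeff = MvPolynomial.C ((q - 1)⁻¹ * (αm - αp) + αm) * detX K := by
      rw [Polynomial.trailingCoeff, ← hm]; exact ha
    have hne : ((q - 1)⁻¹ * (αm - αp) + αm : K) ≠ 0 := by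
      intro h0
      rw [h0, map_zero, zero_mul, Polynomial.trailingCoeff_eq_zero] at htc
      exact hu0 htc
    exact hprod _ _ hne htc
  · have htc : v.trailingCoeff = MvPolynomial.C ((q - 1)⁻¹ * (αm - αp)) * detX K := by
      rw [Polynomial.trailingCoeff, ← hm]; exact hb
    have hne : ((q - 1)⁻¹ * (αm - αp) : K) ≠ 0 := by
      intro h0
      rw [h0, map_zero, zero_mul, Polynomial.trailingCoeff_eq_zero] at htc
      exact hv0 htc
    exact hprod _ _ hne htc

/-! ## The slice determinant of `𝔖(q)` -/

variable (K)

/-- **The `y`-slice of `𝔖(q)` is `Y ⊕ Y^{(q)}`.** [cite: BlaserChristandlZuiddam2017, §2] -/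
theorem Smat_fam (q : K) (y : Fin 2 × Fin 2 → (Rx K)[X]) :
    Smat (fam K q) y = Matrix.fromBlocks (leafMat fun i j => y (i, j)) 0 0
      (leafMat fun i j => y (i, j) * Polynomial.C (MvPolynomial.C (famW K q (i, j)))) := by
  ext x x'
  rcases x with ⟨i, l⟩ | ⟨i, l⟩ <;> rcases x' with ⟨j, l'⟩ | ⟨j, l'⟩ <;>
  · obtain rfl : l = 0 := Subsingleton.elim _ _
    obtain rfl : l' = 0 := Subsingleton.elim _ _
    fin_cases i <;> fin_cases j <;>
      simp [Smat, leafMat, Fintype.sum_prod_type, Fin.sum_univ_two, famW, matMulTensor]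

/-- `famW q b = 1` off `(1,0)`. [folklore] -/
theorem famW_of_ne (q : K) {b : Fin 2 × Fin 2} (hb : b ≠ (1, 0)) : famW K q b = 1 := if_neg hb

/-- `famW q (1,0) = q`. [folklore] -/
@[simp] theorem famW_one_zero (q : K) : famW K q (1, 0) = q := if_pos rfl

/-- **`det S(y) = det Y · (y₀₀y₁₁ - q y₀₁y₁₀)`** for `𝔖(q)`. [folklore] -/
theorem det_Smat_fam (q : K) (y : Fin 2 × Fin 2 → (Rx K)[X]) :
    (Smat (fam K q) y).det = (y (0, 0) * y (1, 1) - y (0, 1) * y (1, 0)) *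
      (y (0, 0) * y (1, 1) - y (0, 1) * y (1, 0) * Polynomial.C (MvPolynomial.C q)) := by
  rw [Smat_fam, Matrix.det_fromBlocks_zero₂₁, det_leafMat, det_leafMat]
  simp only [famW_one_zero, famW_of_ne K q (b := (0, 0)) (by decide),
    famW_of_ne K q (b := (0, 1)) (by decide), famW_of_ne K q (b := (1, 1)) (by decide),
    map_one, mul_one]
  ring

variable {K}

/-- The common core, `q`-version: no degeneration `s ⊵ ⟨2,2,2⟩` when
`det S(y) = det Y · (y₀₀y₁₁ - q y₀₁y₁₀)` with `q ≠ 1`.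
[cite: BurgisserClausenShokrollahi1997, (15.19)] -/
theorem not_algDegeneratesTo_matMul_of_det_slice_q {q : K} (hq1 : q ≠ 1)
    (s : (Fin 2 × Fin 1) ⊕ (Fin 2 × Fin 1) → (Fin 2 × Fin 2) →
      (Fin 2 × Fin 1) ⊕ (Fin 2 × Fin 1) → K)
    (hs : ∀ y : Fin 2 × Fin 2 → (Rx K)[X], (Smat s y).det =
      (y (0, 0) * y (1, 1) - y (0, 1) * y (1, 0)) *
        (y (0, 0) * y (1, 1) - y (0, 1) * y (1, 0) * Polynomial.C (MvPolynomial.C q))) :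
    ¬ AlgDegeneratesTo s (matMulTensor K 2 2 (1 + 1)) := by
  rintro ⟨h, A, B, C, hd⟩
  obtain ⟨p, D, hpD, hD0⟩ := slice_identity hd (Fintype.equivOfCardEq (by simp))
  rw [hs, det_Tmat_matMul] at *
  have hD : D.trailingCoeff = detX K ^ 2 := by
    have h0 : D.coeff 0 ≠ 0 := by rw [hD0]; exact pow_ne_zero _ (detX_ne_zero K)
    have hn : D.natTrailingDegree = 0 :=
      Nat.le_zero.mp (Polynomial.natTrailingDegree_le_of_ne_zero h0)
    rw [Polynomial.trailingCoeff, hn, hD0]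
  have hX : ∀ n : ℕ, ((Polynomial.X : (Rx K)[X]) ^ n).trailingCoeff = 1 := fun n => by
    rw [Polynomial.trailingCoeff, Polynomial.natTrailingDegree_X_pow, Polynomial.coeff_X_pow,
      if_pos rfl]
  have hp : (φK (Fin 2 × Fin 2) p).trailingCoeff =
      MvPolynomial.C (p.coeff (φK (Fin 2 × Fin 2) p).natTrailingDegree) := coeff_φK p _
  have htc := congrArg Polynomial.trailingCoeff hpD
  rw [Polynomial.trailingCoeff_mul, Polynomial.trailingCoeff_mul, Polynomial.trailingCoeff_mul, hX,
    one_mul, hD, hp, ← mul_assoc] at htc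
  have hP : ((yv B (0, 0) * yv B (1, 1) - yv B (0, 1) * yv B (1, 0)).trailingCoeff).IsHomogeneous
      2 := by
    rw [Polynomial.trailingCoeff, Polynomial.coeff_sub]
    exact (coeff_yv_mul_isHomogeneous B _ _ _).sub (coeff_yv_mul_isHomogeneous B _ _ _)
  have hQ : ((yv B (0, 0) * yv B (1, 1) -
      yv B (0, 1) * yv B (1, 0) * Polynomial.C (MvPolynomial.C q)).trailingCoeff).IsHomogeneous
      2 := by
    rw [Polynomial.trailingCoeff, Polynomial.coeff_sub, Polynomial.coeff_mul_C]
    exact (coeff_yv_mul_isHomogeneous B _ _ _).sub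
      ((coeff_yv_mul_isHomogeneous B _ _ _).mul (MvPolynomial.isHomogeneous_C _ q))
  obtain ⟨⟨κ₁, hκ₁, h₁⟩, ⟨κ₂, hκ₂, h₂⟩⟩ := pair_eq_C_mul_detX hP hQ htc
  exact trailing_contradiction_q hq1 (yv B) (coeff_yv_isHomogeneous B) hκ₁ hκ₂ h₁ h₂

variable (K)

/-- **`𝔖(q) ⋭ ⟨2,2,2⟩` for every `q ≠ 1`, over every field.**
[cite: BurgisserClausenShokrollahi1997, (15.19), §20.2] [cite: BlaserChristandlZuiddam2017, §2] -/
theorem fam_not_algDegeneratesTo_matMul {q : K} (hq1 : q ≠ 1) :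
    ¬ AlgDegeneratesTo (fam K q) (matMulTensor K 2 2 (1 + 1)) :=
  not_algDegeneratesTo_matMul_of_det_slice_q hq1 _ (det_Smat_fam K q)

/-- **`⟨2,2,2⟩` is degeneration-incomparable with every non-coherent member `𝔖(q)`,
`q ∉ {0,1}`, of its same-support family — over every field.**
[cite: BurgisserClausenShokrollahi1997, (15.19)] [cite: BlaserChristandlZuiddam2017, §2] -/
theorem matMul_fam_incomparable {q : K} (hq0 : q ≠ 0) (hq1 : q ≠ 1) :
    ¬ AlgDegeneratesTo (matMulTensor K 2 2 (1 + 1)) (fam K q) ∧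
      ¬ AlgDegeneratesTo (fam K q) (matMulTensor K 2 2 (1 + 1)) :=
  ⟨matMul_not_algDegeneratesTo_fam K hq0 hq1, fam_not_algDegeneratesTo_matMul K hq1⟩

/-- The degenerate end `q = 0` (support strictly smaller than `⟨2,2,2⟩`'s) does not reach
`⟨2,2,2⟩` either. [cite: BurgisserClausenShokrollahi1997, (15.19)] -/
theorem fam_zero_not_algDegeneratesTo_matMul :
    ¬ AlgDegeneratesTo (fam K 0) (matMulTensor K 2 2 (1 + 1)) :=
  fam_not_algDegeneratesTo_matMul K zero_ne_one

end Summit.MatrixMultiplication.MatrixMultiplication.Theorems.FarEdgeDescentWeightFamilyDet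

end
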